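import Literature.Geometry.Lorentzian.LeviCivitaProofs
import HarnessLib

/-!
# Any Levi-Civita connection: regularity, curvature = `g.riemann`, and the curvature symmetries

Companion of `Literature/Geometry/Lorentzian/LeviCivitaProofs.lean` and
`CurvatureSymmetries.lean`. The tree phrases metric notions that involve a connection
(`HasPositiveIsotropicCurvature`, the Ricci flow, Hamilton's blocks `A, B, C`, …) over an
*arbitrary* covariant derivative `cov` on `TM` with `g.IsLeviCivita cov` (torsion-free and
`g`-compatible, `LeviCivita.lean`), because Mathlib's `CovariantDerivative` is unconstrained on
non-differentiable sections and so "the" Levi-Civita connection is unique only on differentiable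
fields. The symmetry theorems of `CurvatureSymmetries.lean` / `CurvatureProofs.lean`
(skew-adjointness, pair symmetry, first Bianchi identity), however, ask for the regularity
hypothesis `cov.IsLocallyContMDiff 1`, which `IsLeviCivita` does not record. This file closes the
gap, with no new facts: everything follows from the fundamental lemma proved in
`LeviCivitaProofs.lean` (uniqueness `IsLeviCivita.eq_leviCivita_holds`, existence `hasLeviCivita`,
regularity `isLocallyContMDiff_leviCivita_holds`).

* `IsLeviCivita.isLocallyContMDiff` — a torsion-free `g`-compatible `cov` of a `C^n` metric is
  locally `C^k` for `k + 1 ≤ n` (it agrees with `g.leviCivita` on the `C^{k+1}` fields the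
  definition quantifies over; O'Neill 1983, Ch. 3, Thm. 3.11 with Gallot–Hulin–Lafontaine 2004,
  Prop. 2.54 for the regularity of the Levi-Civita connection).
* `IsLeviCivita.curvatureAux_extend_eq`, `IsLeviCivita.curvatureTensorialAt_iff`,
  `IsLeviCivita.curvature_eq_riemann`, `IsLeviCivita.ricci_eq_ricci` — for `n ≥ 2` the curvature
  tensor (`CovariantDerivative.curvature`, `Curvature.lean`) and the Ricci tensor of any such `cov`
  *are* `g.riemann`, `g.ricci` (O'Neill 1983, Ch. 3, Thm. 3.11 and Lemma 3.35: both the covariant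
  derivative and the bracket are local, and `cov = g.leviCivita` on differentiable fields).
* `IsLeviCivita.val_curvature_skew`, `IsLeviCivita.val_curvature_pair_symm`,
  `IsLeviCivita.curvature_first_bianchi`, `IsLeviCivita.val_curvature_cyclic` — O'Neill 1983,
  Ch. 3, Prop. 3.36 (2)–(4) for the curvature of any Levi-Civita connection of a `C^n` metric,
  `n ≥ 2`, in the form consumed by `Literature/Geometry/Riemannian/` (e.g. Hamilton's Lemma A2.1,
  `CurvatureDecompositionProofs.lean`).

## References

* [ONeill1983] B. O'Neill, *Semi-Riemannian geometry with applications to relativity*, Academic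
  Press 1983, Ch. 3, Thm. 3.11 (pp. 60–61), Lemma 3.35, Prop. 3.36 (pp. 74–76).
* [GallotHulinLafontaine2004] S. Gallot, D. Hulin, J. Lafontaine, *Riemannian Geometry*, 3rd
  ed., Springer 2004, Prop. 2.54 (the connection in coordinates), Prop. 3.5 (symmetries).
-/

noncomputable section

open Bundle Set NormedSpace FiberBundle VectorField
open scoped Manifold ContDiff Topology

namespace Literature.Geometry.Lorentzian

variable {E : Type*} [NormedAddCommGroup E] [NormedSpace ℝ E] {H : Type*} [TopologicalSpace H]
  {I : ModelWithCorners ℝ E H} {M : Type*} [TopologicalSpace M] [ChartedSpace H M]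
  [IsManifold I ∞ M] {n : ℕ∞ω}

namespace PseudoRiemannianMetric

variable {g : PseudoRiemannianMetric I n E (TangentSpace I : M → Type _)}
  [FiniteDimensional ℝ E] [CompleteSpace E]
  {cov : CovariantDerivative I E (TangentSpace I : M → Type _)}

/-! ### Regularity of an arbitrary Levi-Civita connection -/

/-- **A Levi-Civita connection of a `C^n` metric is locally `C^k` for `k + 1 ≤ n`.** A
torsion-free `g`-compatible covariant derivative `cov` agrees with `g.leviCivita` on every field
differentiable at the point (`IsLeviCivita.eq_leviCivita_holds`, O'Neill 1983, Ch. 3, Thm. 3.11),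
in particular on the `C^{k+1}` fields on open sets over which `CovariantDerivative.IsLocallyContMDiff`
quantifies, and `g.leviCivita` is locally `C^k` (`isLocallyContMDiff_leviCivita_holds`,
Gallot–Hulin–Lafontaine 2004, Prop. 2.54). [cite: ONeill1983, Ch. 3, Thm. 3.11] -/
theorem IsLeviCivita.isLocallyContMDiff [Fact (1 ≤ n)] (h : g.IsLeviCivita cov) (k : ℕ∞)
    (hk : (k : ℕ∞ω) + 1 ≤ n) : cov.IsLocallyContMDiff k := by
  haveI := g.hasLeviCivita
  intro u hu
  have hLC : ContMDiffCovariantDerivativeOn E k g.leviCivita.toFun u :=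
    g.isLocallyContMDiff_leviCivita_holds k hk u hu
  refine ⟨fun {σ} hσ ↦ ?_⟩
  refine (hLC.contMDiff hσ).congr fun x hx ↦ ?_
  have hσx : MDiffAt (T% σ) x :=
    ((hσ x hx).contMDiffAt (hu.mem_nhds hx)).mdifferentiableAt (by simp)
  rw [IsLeviCivita.eq_leviCivita_holds h hσx]

/-- A Levi-Civita connection of a `C^n` metric, `n ≥ 2`, is locally `C¹` — the regularity
hypothesis of the curvature identities of `CurvatureProofs.lean` / `CurvatureSymmetries.lean`.
[cite: ONeill1983, Ch. 3, Thm. 3.11] -/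
theorem IsLeviCivita.isLocallyContMDiff_one (h : g.IsLeviCivita cov) (hn : 2 ≤ n) :
    cov.IsLocallyContMDiff 1 :=
  haveI : Fact (1 ≤ n) := ⟨le_trans (by norm_num) hn⟩
  h.isLocallyContMDiff 1 (by rwa [show ((1 : ℕ∞) : ℕ∞ω) + 1 = 2 by norm_num])

/-! ### The curvature of any Levi-Civita connection is `g.riemann` -/

section Riemann

variable [Fact (1 ≤ n)] [g.HasLeviCivita]

/-- **The curvature operation of a Levi-Civita connection on extended vectors is that of
`g.leviCivita`.** For `cov` torsion-free and `g`-compatible (`C^n` metric, `n ≥ 2`) and tangent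
vectors `X₀, Y₀, Z₀` at `x`, the bare curvature `∇_X ∇_Y Z - ∇_Y ∇_X Z - ∇_{[X,Y]} Z` at `x` of the
canonical extensions is the same for `cov` and for `g.leviCivita`: the extensions are `C²` near
`x`, so `∇Z` computed with `cov` and with `g.leviCivita` agree near `x` (uniqueness on
differentiable fields, O'Neill 1983, Thm. 3.11), the iterated derivatives `∇_Y Z`, `∇_X Z` are
differentiable at `x` (`g.leviCivita` is locally `C¹`), and a covariant derivative is local on
sections differentiable at the point (Mathlib's `IsCovariantDerivativeOn.congr_of_eventuallyEq`;
O'Neill 1983, proof of Lemma 3.35). [cite: ONeill1983, Ch. 3, Thm. 3.11 and Lemma 3.35] -/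
theorem IsLeviCivita.curvatureAux_extend_eq (h : g.IsLeviCivita cov) (hn : 2 ≤ n) (x : M)
    (X₀ Y₀ Z₀ : TangentSpace I x) :
    CovariantDerivative.curvatureAux cov (extend E X₀) (extend E Y₀) (extend E Z₀) x =
      CovariantDerivative.curvatureAux g.leviCivita (extend E X₀) (extend E Y₀) (extend E Z₀) x := by
  have hI3 : IsManifold I (minSmoothness ℝ 3) M := by
    rw [minSmoothness_of_isRCLikeNormedField]; infer_instance
  have hregLC : g.leviCivita.IsLocallyContMDiff 1 :=
    g.isLocallyContMDiff_leviCivita_holds 1 (by rwa [show ((1 : ℕ∞) : ℕ∞ω) + 1 = 2 by norm_num])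
  obtain ⟨uX, huX, hxX, hX2⟩ := CovariantDerivative.exists_isOpen_contMDiffOn_extend (I := I) X₀
  obtain ⟨uY, huY, hxY, hY2⟩ := CovariantDerivative.exists_isOpen_contMDiffOn_extend (I := I) Y₀
  obtain ⟨uZ, huZ, hxZ, hZ2⟩ := CovariantDerivative.exists_isOpen_contMDiffOn_extend (I := I) Z₀
  set X := extend E X₀ with hXdef
  set Y := extend E Y₀ with hYdef
  set Z := extend E Z₀ with hZdef
  -- `cov Z = ∇ Z` on the open set `uZ ∋ x` where `Z` is `C²`
  have hZeq : ∀ y ∈ uZ, cov Z y = g.leviCivita Z y := fun y hy ↦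
    IsLeviCivita.eq_leviCivita_holds h
      (CovariantDerivative.mdifferentiableAt_of_contMDiffOn_two huZ hZ2 hy)
  -- the iterated derivative along a `C²` field `W` (here `W = X` or `Y`)
  have key : ∀ {W : Π y : M, TangentSpace I y} {uW : Set M}, IsOpen uW → x ∈ uW →
      CMDiff[uW] 2 (T% W) →
      cov (fun y ↦ cov Z y (W y)) x = g.leviCivita (fun y ↦ g.leviCivita Z y (W y)) x := by
    intro W uW huW hxW hW2
    have hS' : MDiffAt (T% (fun y ↦ g.leviCivita Z y (W y))) x :=
      g.leviCivita.mdifferentiableAt_cov_apply hregLC (huW.inter huZ) ⟨hxW, hxZ⟩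
        ((hW2.of_le (by norm_num)).mono inter_subset_left) (hZ2.mono inter_subset_right)
    have hSeq : (fun y ↦ cov Z y (W y)) =ᶠ[𝓝 x] (fun y ↦ g.leviCivita Z y (W y)) :=
      Filter.eventuallyEq_of_mem (huZ.mem_nhds hxZ) fun y hy ↦ by simp only [hZeq y hy]
    have hS : MDiffAt (T% (fun y ↦ cov Z y (W y))) x := by
      refine hS'.congr_of_eventuallyEq ?_
      filter_upwards [hSeq] with y hy
      simp only [hy]
    rw [cov.isCovariantDerivativeOn.congr_of_eventuallyEq hS hS' Filter.univ_mem hSeq]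
    exact IsLeviCivita.eq_leviCivita_holds h hS'
  simp only [CovariantDerivative.curvatureAux, key huY hxY hY2, key huX hxX hX2, hZeq x hxZ]

/-- Hence `cov` has a curvature tensor at `x` iff `g.leviCivita` does (and both do, `n ≥ 2`).
[cite: ONeill1983, Ch. 3, Lemma 3.35] -/
theorem IsLeviCivita.curvatureTensorialAt_iff (h : g.IsLeviCivita cov) (hn : 2 ≤ n) (x : M) :
    cov.CurvatureTensorialAt x ↔ g.leviCivita.CurvatureTensorialAt x := by
  unfold CovariantDerivative.CurvatureTensorialAt
  simp only [h.curvatureAux_extend_eq hn x]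

/-- **The curvature tensor of any Levi-Civita connection of `g` is the Riemann tensor of `g`**
(`g.riemann = g.leviCivita.curvature`, `LeviCivita.lean`): for `cov` torsion-free and
`g`-compatible, `C^n` metric with `n ≥ 2`, `cov.curvature x = g.riemann x` at every point —
O'Neill 1983, Ch. 3, Thm. 3.11 (uniqueness of the Levi-Civita connection) with Lemma 3.35 (the
curvature is determined by the connection on local fields). [cite: ONeill1983, Ch. 3, Thm. 3.11 and Lemma 3.35] -/
theorem IsLeviCivita.curvature_eq_riemann (h : g.IsLeviCivita cov) (hn : 2 ≤ n) (x : M) :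
    cov.curvature x = g.riemann x := by
  change cov.curvature x = g.leviCivita.curvature x
  by_cases hc : cov.CurvatureTensorialAt x
  · have hLC : g.leviCivita.CurvatureTensorialAt x := (h.curvatureTensorialAt_iff hn x).1 hc
    ext X₀ Y₀ Z₀
    rw [cov.curvature_apply_eq_extend hc, g.leviCivita.curvature_apply_eq_extend hLC,
      h.curvatureAux_extend_eq hn x]
  · have hLC : ¬ g.leviCivita.CurvatureTensorialAt x := fun h' ↦
      hc ((h.curvatureTensorialAt_iff hn x).2 h')
    rw [cov.curvature_of_not_curvatureTensorialAt hc,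
      g.leviCivita.curvature_of_not_curvatureTensorialAt hLC]

/-- **The Ricci tensor of any Levi-Civita connection of `g` is `g.ricci`** (`n ≥ 2`).
[cite: ONeill1983, Ch. 3, Thm. 3.11 and Lemma 3.52] -/
theorem IsLeviCivita.ricci_eq_ricci (h : g.IsLeviCivita cov) (hn : 2 ≤ n) (x : M) :
    cov.ricci x = g.ricci x := by
  ext X₀ Y₀
  rw [ricci_apply, CovariantDerivative.ricci_apply, CovariantDerivative.ricci_apply]
  congr 1
  ext v
  simp only [CovariantDerivative.ricciAux_apply, h.curvature_eq_riemann hn x]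
  rfl

end Riemann

/-! ### The curvature symmetries for any Levi-Civita connection -/

/-- **Skew-adjointness** `g(R(X,Y)Z, W) = -g(R(X,Y)W, Z)` for the curvature of any Levi-Civita
connection of a `C^n` metric, `n ≥ 2` (O'Neill 1983, Ch. 3, Prop. 3.36 (2)): `val_curvature_skew`
with the regularity supplied by `IsLeviCivita.isLocallyContMDiff_one`.
[cite: ONeill1983, Ch. 3, Prop. 3.36 (2), p. 75] -/
theorem IsLeviCivita.val_curvature_skew (h : g.IsLeviCivita cov) (hn : 2 ≤ n) (x : M)
    (X₀ Y₀ Z₀ W₀ : TangentSpace I x) :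
    g.val x (cov.curvature x X₀ Y₀ Z₀) W₀ = -g.val x (cov.curvature x X₀ Y₀ W₀) Z₀ :=
  PseudoRiemannianMetric.val_curvature_skew h.2 (h.isLocallyContMDiff_one hn) hn x X₀ Y₀ Z₀ W₀

/-- **Pair symmetry** `g(R(X,Y)Z, W) = g(R(Z,W)X, Y)` for the curvature of any Levi-Civita
connection of a `C^n` metric, `n ≥ 2` (O'Neill 1983, Ch. 3, Prop. 3.36 (4)).
[cite: ONeill1983, Ch. 3, Prop. 3.36 (4), pp. 75–76] -/
theorem IsLeviCivita.val_curvature_pair_symm (h : g.IsLeviCivita cov) (hn : 2 ≤ n) (x : M)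
    (X₀ Y₀ Z₀ W₀ : TangentSpace I x) :
    g.val x (cov.curvature x X₀ Y₀ Z₀) W₀ = g.val x (cov.curvature x Z₀ W₀ X₀) Y₀ :=
  PseudoRiemannianMetric.val_curvature_pair_symm h.2 (h.isLocallyContMDiff_one hn) h.1 hn x X₀ Y₀
    Z₀ W₀

/-- **First Bianchi identity** `R(X,Y)Z + R(Y,Z)X + R(Z,X)Y = 0` for the curvature of any
Levi-Civita connection of a `C^n` metric, `n ≥ 2` (O'Neill 1983, Ch. 3, Prop. 3.36 (3)):
`CovariantDerivative.curvature_first_bianchi` (torsion-freeness and local `C¹` regularity; the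
`C^∞` manifold is `C³`). [cite: ONeill1983, Ch. 3, Prop. 3.36 (3), pp. 75–76] -/
theorem IsLeviCivita.curvature_first_bianchi (h : g.IsLeviCivita cov) (hn : 2 ≤ n) (x : M)
    (X₀ Y₀ Z₀ : TangentSpace I x) :
    cov.curvature x X₀ Y₀ Z₀ + cov.curvature x Y₀ Z₀ X₀ + cov.curvature x Z₀ X₀ Y₀ = 0 := by
  have hI3 : IsManifold I (minSmoothness ℝ 3) M := by
    rw [minSmoothness_of_isRCLikeNormedField]; infer_instance
  exact cov.curvature_first_bianchi (h.isLocallyContMDiff_one hn) h.1 X₀ Y₀ Z₀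

/-- First Bianchi identity paired with a fourth vector:
`g(R(X,Y)Z, W) + g(R(Y,Z)X, W) + g(R(Z,X)Y, W) = 0` (O'Neill 1983, Ch. 3, Prop. 3.36 (3)).
[cite: ONeill1983, Ch. 3, Prop. 3.36 (3), pp. 75–76] -/
theorem IsLeviCivita.val_curvature_cyclic (h : g.IsLeviCivita cov) (hn : 2 ≤ n) (x : M)
    (X₀ Y₀ Z₀ W₀ : TangentSpace I x) :
    g.val x (cov.curvature x X₀ Y₀ Z₀) W₀ + g.val x (cov.curvature x Y₀ Z₀ X₀) W₀ +
      g.val x (cov.curvature x Z₀ X₀ Y₀) W₀ = 0 := by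
  have := congrArg (fun T : TangentSpace I x ↦ g.val x T W₀) (h.curvature_first_bianchi hn x X₀ Y₀ Z₀)
  simpa only [map_add, map_zero, add_apply, zero_apply] using this

omit [FiniteDimensional ℝ E] [CompleteSpace E] in
/-- **Antisymmetry in the first pair**, paired: `g(R(X,Y)Z, W) = -g(R(Y,X)Z, W)` (O'Neill 1983,
Ch. 3, Prop. 3.36 (1); unconditional, `CovariantDerivative.curvature_antisymm`).
[cite: ONeill1983, Ch. 3, Prop. 3.36 (1), p. 75] -/
theorem val_curvature_antisymm (x : M) (X₀ Y₀ Z₀ W₀ : TangentSpace I x) :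
    g.val x (cov.curvature x X₀ Y₀ Z₀) W₀ = -g.val x (cov.curvature x Y₀ X₀ Z₀) W₀ := by
  rw [cov.curvature_antisymm X₀ Y₀ Z₀, map_neg]
  rfl

end PseudoRiemannianMetric

end Literature.Geometry.Lorentzian

end
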